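import Summits.RiemannHypothesis.RiemannHypothesis.Theorems.Splittings.LiIncrHighPart
import HarnessLib

/-!
# T-Li3 IN KERNEL: `RH → TLi3.LiIncrBlockLaw` eventually (stub [δ]) and `RH ↔ AlmostAllLiMonotone` (li-bridge g6 Parts D + T)

Cell rh-split, seat rh-split-li-bridge g6 (brief sha16 f79c5f09d8bcb036), card `run/shared/lean/pub/rh-split/cards/SPLIT-li-bridge.md` §13
(13.5 paper proof «SOUND ON PAPER», referee rh-split-ref g3 06:17:36Z; 13.17); kernel source `HOME/rh-split-li-bridge/SketchG6T.lean` sha16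
911a043700f05677 (2287 l; = SketchG6B [γ] ++ SketchG6C [α][β] ++ Part D [δ] ++ Part T, re-pointed at the tree's `LiIncrMeanSquare` /
`LiIncrBlockLaw`, p508264 / p508611).  Filed by rh-split-typer-2 g4 (lane (xi)(c)–(f)) as a chain of ten tree modules cut at the scratch's
section boundaries, decl text byte-verbatim; deltas = namespaces `RhSplit.LiBridgeG6B/C/D/T` ↦
`…Theorems.Splittings.{LiLowZeroBudget, LiIncrHighPart, LiIncrBlockLawOfRH}` (qualified cross-references rewritten), module docstrings, and
one-line docstrings added where the scratch had none.  END-TO-END statement of the chain (last file):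
`LiIncrBlockLawOfRH.rh_iff_almostAllLiMonotone : RiemannHypothesis ↔ ∃ E ⊆ ℕ of natural density zero, ∀ n ≥ 1, n ∉ E → λ_n ≤ λ_{n+1}`
— T-Li3 IN KERNEL, a RELABELLING of RH (RH-EQUIVALENT, PROVED; certifies nothing about RH; class (li, bridge) unchanged).

This file: Part D: `blockLaw_of_RH` / `blockLaw_of_RH'` assemble [α]+[β]+[γ] into the TREE's typed block law `Splittings.LiIncrBlockLaw.TLi3.LiIncrBlockLaw c K N`
on every dyadic block `[N, 2N)`, `N ≥ N₀`, ASSUMING RH; Part T: `rh_iff_almostAllLiMonotone := TLi3.rh_iff_almostAllLiMonotone_of_blockLaw blockLaw_of_RH'`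
(← is the tree's T-Li2 `LiExtremalLayer.rh_of_liIncr_nonneg_off_densityZero`, p498482); `rh_iff_almostAllLiMonotone_root` (Mathlib's `RiemannHypothesis`).

HONEST LABEL: «SPLITTING SEARCH over kernel-typed RH-EQUIVALENCES; a splitting A ∧ B ⟹ RH is CONDITIONAL bookkeeping unless A and B are
both proved; nothing here bears on the truth of RH.»
-/

set_option linter.dupNamespace false

noncomputable section

namespace Summit.RiemannHypothesis.RiemannHypothesis.Theorems.Splittings.LiIncrBlockLawOfRH

open Filter Topology Finset
open Literature.NumberTheory.LFunctions Literature.NumberTheory.LFunctions.SchoenfeldBound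
open Summit.RiemannHypothesis.RiemannHypothesis.Theorems.LiTheory
open Summit.RiemannHypothesis.RiemannHypothesis.Theorems.Splittings.LiLowZeroBudget (ampM phase phase_mem fourteen_lt_im blockLaw_budget_clause_log)
open Summit.RiemannHypothesis.RiemannHypothesis.Theorems.Splittings.LiIncrMeanSquare.MeanSquare
  (dirichletBound)
open Summit.RiemannHypothesis.RiemannHypothesis.Theorems.Splittings.LiIncrBlockLaw (TLi3.LiIncrBlockLaw)
open Summit.RiemannHypothesis.RiemannHypothesis.Theorems.Splittings.LiIncrHighPart (liIncr highPart lowSum liIncr_eq_highPart_add_lowSum highPart_lower)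


/-- Re-indexing a finite set of complex numbers by an initial segment of `ℕ`. -/
theorem reindex_nat (s : Finset ℂ) :
    ∃ (m : ℕ) (σ : ℕ → ℂ), (∀ j ∈ Finset.range m, σ j ∈ s) ∧
      ∀ g : ℂ → ℝ, ∑ j ∈ Finset.range m, g (σ j) = ∑ i ∈ s, g i := by
  classical
  refine ⟨s.card, fun j ↦ if h : j < s.card then ((s.equivFin.symm ⟨j, h⟩ : s) : ℂ) else 0,
    ?_, ?_⟩
  · intro j hj
    rw [Finset.mem_range] at hj
    simp only [dif_pos hj]
    exact (s.equivFin.symm ⟨j, hj⟩).2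
  · intro g
    rw [Finset.sum_range]
    have h1 : ∀ j : Fin s.card,
        g (if h : (j : ℕ) < s.card then ((s.equivFin.symm ⟨j, h⟩ : s) : ℂ) else 0) =
          g ((s.equivFin.symm j : s) : ℂ) := fun j ↦ by
      simp only [dif_pos j.isLt, Fin.eta]
    rw [Fintype.sum_congr _ _ h1, Equiv.sum_comp s.equivFin.symm (fun x : s ↦ g (x : ℂ)),
      Finset.sum_coe_sort s g]

/-- The low sum of `SketchG6C` in the amplitude/phase vocabulary of `SketchG6B`. -/
theorem lowSum_eq (n : ℕ) (Y : ℝ) :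
    lowSum n Y = ∑ ρ ∈ zerosBetween 0 Y, ampM ρ * Real.sin (((n : ℝ) + 1 / 2) * phase ρ) := by
  unfold lowSum ampM Summit.RiemannHypothesis.RiemannHypothesis.Theorems.Splittings.LiLowZeroBudget.amp phase Summit.RiemannHypothesis.RiemannHypothesis.Theorems.Splittings.LiLowZeroBudget.mult
    Summit.RiemannHypothesis.RiemannHypothesis.Theorems.Splittings.LiIncrHighPart.mult
  rfl

/-- `4√N (log(2N) + 2) ≤ N` eventually. -/
theorem eventually_sqrt_log_le :
    ∀ᶠ N : ℕ in atTop, 4 * Real.sqrt N * (Real.log (2 * (N : ℝ)) + 2) ≤ N := by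
  have h1 : ∀ᶠ x : ℝ in atTop, ‖Real.log x‖ ≤ 1 / 16 * ‖x ^ ((1 : ℝ) / 2)‖ :=
    (isLittleO_log_rpow_atTop (by norm_num : (0 : ℝ) < 1 / 2)).bound (by norm_num)
  have h2 := tendsto_natCast_atTop_atTop.eventually h1
  filter_upwards [h2, eventually_ge_atTop 900] with N hN hN900
  have hNr : (900 : ℝ) ≤ N := by exact_mod_cast hN900
  have hN0 : (0 : ℝ) < N := by linarith
  rw [Real.norm_eq_abs, Real.norm_eq_abs, ← Real.sqrt_eq_rpow,
    abs_of_nonneg (Real.log_nonneg (by linarith)), abs_of_nonneg (Real.sqrt_nonneg _)] at hN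
  have hsq : Real.sqrt N * Real.sqrt N = N := Real.mul_self_sqrt hN0.le
  have h30 : 30 ≤ Real.sqrt N :=
    calc (30 : ℝ) = Real.sqrt (30 ^ 2) := (Real.sqrt_sq (by norm_num)).symm
      _ ≤ Real.sqrt N := Real.sqrt_le_sqrt (by linarith)
  have hlog2 : Real.log (2 * (N : ℝ)) ≤ Real.log N + 0.7 := by
    rw [Real.log_mul two_ne_zero hN0.ne']
    linarith [Real.log_two_lt_d9]
  have hs0 : 0 ≤ Real.sqrt (N : ℝ) := Real.sqrt_nonneg _
  have a1 : 4 * Real.sqrt N * (Real.log (2 * (N : ℝ)) + 2) ≤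
      4 * Real.sqrt N * (Real.sqrt N / 16 + 2.7) :=
    mul_le_mul_of_nonneg_left (by linarith) (by positivity)
  have a2 : 4 * Real.sqrt N * (Real.sqrt N / 16 + 2.7) = N / 4 + 10.8 * Real.sqrt N := by
    linear_combination (1 / 4 : ℝ) * hsq
  have a3 : 10.8 * Real.sqrt N ≤ 3 / 4 * N := by nlinarith
  linarith

/-- **Stub [δ] composed with [α] [β] [γ]: RH ⟹ the typed block law on every large dyadic block.**
`c = 1/10`, `K` = the RH-free budget constant at `λ = 1` (`Y = √N`), `P(n) = P_{√N}(n)` the high part,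
`s, a, θ` = the zeros `0 < γ ≤ √N` re-indexed by naturals with `a = 4 m sin(θ_γ/2)`, `θ = θ_γ`. -/
theorem blockLaw_of_RH (hRH : RiemannHypothesis) :
    ∃ c : ℝ, 0 < c ∧ ∃ K : ℝ, ∃ N₀ : ℕ, ∀ N : ℕ, N₀ ≤ N → TLi3.LiIncrBlockLaw c K N := by
  obtain ⟨K, -, hK⟩ := blockLaw_budget_clause_log (lam := 1) le_rfl
  have hev : ∀ᶠ N : ℕ in atTop, (4 * Real.sqrt N * (Real.log (2 * (N : ℝ)) + 2) ≤ N ∧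
      250 ≤ Real.log (N : ℝ)) ∧ 900 ≤ N :=
    (eventually_sqrt_log_le.and
      ((Real.tendsto_log_atTop.comp tendsto_natCast_atTop_atTop).eventually_ge_atTop 250)).and
      (eventually_ge_atTop 900)
  obtain ⟨N₀, hN₀⟩ := Filter.eventually_atTop.1 hev
  refine ⟨1 / 10, by norm_num, K, N₀, fun N hN ↦ ?_⟩
  obtain ⟨⟨hE2, hE3⟩, hE1⟩ := hN₀ N hN
  set Y : ℝ := Real.sqrt N with hYdef
  have hNr : (900 : ℝ) ≤ N := by exact_mod_cast hE1
  have hN0 : (0 : ℝ) < N := by linarith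
  have hY30 : 30 ≤ Y :=
    calc (30 : ℝ) = Real.sqrt (30 ^ 2) := (Real.sqrt_sq (by norm_num)).symm
      _ ≤ Real.sqrt N := Real.sqrt_le_sqrt (by linarith)
  have hY0 : 0 ≤ Y := by linarith
  have hY2 : Y ^ 2 = N := by rw [hYdef, Real.sq_sqrt hN0.le]
  obtain ⟨m, σ, hσ, hsum⟩ := reindex_nat (zerosBetween 0 Y)
  refine ⟨Finset.range m, fun j ↦ ampM (σ j), fun j ↦ phase (σ j), fun n ↦ highPart n Y,
    ?_, ?_, ?_, ?_⟩
  · intro j hj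
    exact phase_mem (fourteen_lt_im (hσ j hj))
  · intro n _
    dsimp only
    rw [hsum (fun ρ ↦ ampM ρ * Real.sin (((n : ℝ) + 1 / 2) * phase ρ)), ← lowSum_eq]
    exact liIncr_eq_highPart_add_lowSum n Y
  · intro n hn
    rw [Finset.mem_Ico] at hn
    obtain ⟨hNn, hn2⟩ := hn
    have hn1 : 1 ≤ n := by omega
    have hnr : (N : ℝ) ≤ n := by exact_mod_cast hNn
    have hn2r : (n : ℝ) + 1 ≤ 2 * N := by exact_mod_cast (by omega : n + 1 ≤ 2 * N)
    have hlogn1 : Real.log ((n : ℝ) + 1) ≤ Real.log (2 * (N : ℝ)) :=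
      Real.log_le_log (by positivity) hn2r
    have hcond : 4 * Y * (Real.log ((n : ℝ) + 1) + 2) ≤ n :=
      calc 4 * Y * (Real.log ((n : ℝ) + 1) + 2) ≤ 4 * Y * (Real.log (2 * (N : ℝ)) + 2) :=
            mul_le_mul_of_nonneg_left (by linarith) (by positivity)
        _ ≤ N := hE2
        _ ≤ n := hnr
    have hβ := highPart_lower hRH hn1 hY30 hcond
    have hlogY : Real.log Y = Real.log N / 2 := by rw [hYdef, Real.log_sqrt hN0.le]
    have hlogn : Real.log N ≤ Real.log n := Real.log_le_log hN0 hnr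
    have hlogN0 : 0 ≤ Real.log (N : ℝ) := Real.log_nonneg (by linarith)
    rw [hlogY, hY2] at hβ
    have hfrac : (n : ℝ) * (0.34 * (Real.log N / 2) + 3.5) / N ≤
        2 * (0.34 * (Real.log N / 2) + 3.5) := by
      rw [div_le_iff₀ hN0]
      have := mul_le_mul_of_nonneg_right (by linarith : (n : ℝ) ≤ 2 * N)
        (by positivity : (0 : ℝ) ≤ 0.34 * (Real.log N / 2) + 3.5)
      linarith
    show 1 / 10 * Real.log N ≤ highPart n Y
    linarith
  · calc ∑ j ∈ Finset.range m, ∑ k ∈ Finset.range m,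
          |ampM (σ j)| * |ampM (σ k)| * dirichletBound N (phase (σ j) - phase (σ k))
        = ∑ j ∈ Finset.range m, ∑ ρ' ∈ zerosBetween 0 Y,
            |ampM (σ j)| * |ampM ρ'| * dirichletBound N (phase (σ j) - phase ρ') :=
          Finset.sum_congr rfl fun j _ ↦
            hsum (fun ρ' ↦ |ampM (σ j)| * |ampM ρ'| * dirichletBound N (phase (σ j) - phase ρ'))
      _ = ∑ ρ ∈ zerosBetween 0 Y, ∑ ρ' ∈ zerosBetween 0 Y,
            |ampM ρ| * |ampM ρ'| * dirichletBound N (phase ρ - phase ρ') :=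
          hsum (fun ρ ↦ ∑ ρ' ∈ zerosBetween 0 Y,
            |ampM ρ| * |ampM ρ'| * dirichletBound N (phase ρ - phase ρ'))
      _ ≤ K * N * Real.log N := hK N Y (by omega) hY0 (by rw [hY2, one_mul])

/-- The same with the summit spelling `Summit.RiemannHypothesis`: exactly the hypothesis `hT3` of the
TREE's `Splittings.LiIncrBlockLaw.TLi3.rh_iff_almostAllLiMonotone_of_blockLaw` (p508611), discharged. -/
theorem blockLaw_of_RH' :
    Summit.RiemannHypothesis → ∃ c : ℝ, 0 < c ∧ ∃ K : ℝ, ∃ N₀ : ℕ,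
      ∀ N : ℕ, N₀ ≤ N → TLi3.LiIncrBlockLaw c K N :=
  fun hRH ↦ blockLaw_of_RH hRH

open Filter Finset
open Literature.NumberTheory.LFunctions
open Summit.RiemannHypothesis.RiemannHypothesis.Theorems.Splittings.LiIncrBlockLaw


open Classical in
/-- **END-TO-END (kernel RH-equivalence, a RELABELLING of RH in the Li-increment language).**
`RH ↔ (λ_n ≤ λ_{n+1} for all n ≥ 1 off a set of natural density zero)`: `→` = the tree's T-Li3
REDUCED (`TLi3.rh_iff_almostAllLiMonotone_of_blockLaw`, p508611: Chebyshev on dyadic blocks + the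
mean-square engine p508264) fed with this file's `blockLaw_of_RH'` ([α][β][γ][δ]); `←` = tree T-Li2
(`LiExtremalLayer.rh_of_liIncr_nonneg_off_densityZero`, p498482). Nothing here bears on the truth of RH. -/
theorem rh_iff_almostAllLiMonotone :
    Summit.RiemannHypothesis ↔
      ∃ E : Set ℕ, (∀ ε : ℝ, 0 < ε → ∀ᶠ N : ℕ in atTop,
          (((range N).filter (fun n => n ∈ E)).card : ℝ) ≤ ε * N) ∧
        ∀ n : ℕ, 1 ≤ n → n ∉ E → keiperLiCoeff n ≤ keiperLiCoeff (n + 1) :=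
  TLi3.rh_iff_almostAllLiMonotone_of_blockLaw Summit.RiemannHypothesis.RiemannHypothesis.Theorems.Splittings.LiIncrBlockLawOfRH.blockLaw_of_RH'

open Classical in
/-- The same with the root spelling `RiemannHypothesis`. -/
theorem rh_iff_almostAllLiMonotone_root :
    RiemannHypothesis ↔
      ∃ E : Set ℕ, (∀ ε : ℝ, 0 < ε → ∀ᶠ N : ℕ in atTop,
          (((range N).filter (fun n => n ∈ E)).card : ℝ) ≤ ε * N) ∧
        ∀ n : ℕ, 1 ≤ n → n ∉ E → keiperLiCoeff n ≤ keiperLiCoeff (n + 1) :=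
  rh_iff_almostAllLiMonotone

end Summit.RiemannHypothesis.RiemannHypothesis.Theorems.Splittings.LiIncrBlockLawOfRH

end
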